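import Summits.Ventures.PercRepro.Night2FourCells
import Summits.Ventures.PercRepro.Night2PartialCellsB
import Summits.Ventures.PercRepro.Night2SpreadCellsB

/-!
# PercRepro — the `(7, 5)` shadow row modulo its FAT-HYPERPLANE RESIDUES (night-2, gen 19)

`shadowHall_seven_five_of_local_d_le_three` reduced the `(7, 5)` shadow row to the five cells `(2,0), (2,1), (3,0),
(3,1), (3,2)`.  Each is a kernel theorem in its spread regime (`Night2LocalSpread`: every thin member misses `≥ m₀`
points), in its partial-spread regime (`Night2PartialCells`, `Night2PartialCellsB`: every NON-BASIS thin member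
misses `≥ m₁` points), in its two-parameter regime (`Night2SpreadCells`: basis members `≥ m₂`, non-basis `≥ m₁`), and
`(3, 0)` / `(3, 1)` also for large flats (`Night2ThreeCells`).  So **`shadowHall_seven_five_of_residues`**: the `(7, 5)`
shadow row — hence the C-025 body at `(7, 5)` through `c025_of_shadowHall` — for every finite matroid modulo the
RESIDUES alone, each the conjunction of the failures of those regimes («a thin member missing `≤ m` points» =
a fat bottom-set closure; «basis» = `|B ∖ K| + 1 = ρ`, «non-basis» = `|B ∖ K| ≥ ρ`):
* `(2, 0)`: a thin member missing `≤ 4` AND a non-basis member missing `≤ 5` AND (a basis member missing `≤ 3` OR a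
  non-basis member missing `≤ 2`) AND (a basis member missing `≤ 2` OR a non-basis member missing `≤ 3`);
* `(2, 1)`: a non-basis member missing `≤ 6` AND (a basis member missing `≤ 3` OR a non-basis member missing `≤ 3`) AND
  (a basis member missing `≤ 2` OR a non-basis member missing `≤ 4`);
* `(3, 0)`: `|G| ≤ 15` AND a thin member missing `≤ 3` AND a non-basis member missing `≤ 3` AND a basis member missing
  `≤ 2`;
* `(3, 1)`: `|G| ≤ 20` AND a thin member missing `≤ 5` AND a non-basis member missing `≤ 3` AND a basis member missing
  `≤ 4` AND (a basis member missing `≤ 2` OR a non-basis member missing `≤ 2`);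
* `(3, 2)`: a non-basis member missing `≤ 4` AND (a basis member missing `≤ 3` OR a non-basis member missing `≤ 2`) AND
  (a basis member missing `≤ 2` OR a non-basis member missing `≤ 3`).
-/

namespace PercRepro.Shadow

open Finset PerFlat ThmH

section SevenFive

variable {α' : Type} [DecidableEq α']

/-- The standing hypotheses of a cell: loopless simple rank-`7`, a rank-`6` flat. -/
abbrev CellHyp (N : Matroid α') [N.Finite] (G : Finset α') : Prop :=
  (∀ e ∈ gr N, ∀ f ∈ gr N, e ≠ f → rkN N {e, f} = 2) ∧ (∀ e ∈ gr N, N.Indep {e}) ∧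
    N.eRank = ((5 + 2 : ℕ) : ℕ∞) ∧ G ∈ flatsQ N (5 + 1)

/-- «a thin member with `|B ∖ K| ≥ a` missing at most `m` points». -/
abbrev FatMember (N : Matroid α') [N.Finite] (G : Finset α') (a m : ℕ) : Prop :=
  ∃ B ∈ thinMembers N 5 G, a ≤ (B \ coloops N G).card ∧ (G \ clF N B).card ≤ m

/-- «a basis member (`|B ∖ K| + 1 = ρ`) missing at most `m` points». -/
abbrev FatBasis (N : Matroid α') [N.Finite] (G : Finset α') (ρ m : ℕ) : Prop :=
  ∃ B ∈ thinMembers N 5 G, (B \ coloops N G).card + 1 = ρ ∧ (G \ clF N B).card ≤ m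

/-- **THE `(7, 5)` SHADOW ROW FOR EVERY FINITE MATROID MODULO THE FAT-HYPERPLANE RESIDUES** (see the module
docstring for the five residues). -/
theorem shadowHall_seven_five_of_residues
    (h20 : ∀ (N : Matroid α') [N.Finite] (G : Finset α'), CellHyp N G →
      (gr N \ G).card = 2 → kColoops N G = 0 → FatMember N G 0 4 → FatMember N G 6 5 →
      (FatBasis N G 6 3 ∨ FatMember N G 6 2) → (FatBasis N G 6 2 ∨ FatMember N G 6 3) → LocalShadowHall N 5 G)
    (h21 : ∀ (N : Matroid α') [N.Finite] (G : Finset α'), CellHyp N G →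
      (gr N \ G).card = 2 → kColoops N G = 1 → FatMember N G 5 6 →
      (FatBasis N G 5 3 ∨ FatMember N G 5 3) → (FatBasis N G 5 2 ∨ FatMember N G 5 4) → LocalShadowHall N 5 G)
    (h30 : ∀ (N : Matroid α') [N.Finite] (G : Finset α'), CellHyp N G →
      (gr N \ G).card = 3 → kColoops N G = 0 → G.card ≤ 15 → FatMember N G 0 3 → FatMember N G 6 3 →
      FatBasis N G 6 2 → LocalShadowHall N 5 G)
    (h31 : ∀ (N : Matroid α') [N.Finite] (G : Finset α'), CellHyp N G →
      (gr N \ G).card = 3 → kColoops N G = 1 → G.card ≤ 20 → FatMember N G 0 5 → FatMember N G 5 3 →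
      FatBasis N G 5 4 → (FatBasis N G 5 2 ∨ FatMember N G 5 2) → LocalShadowHall N 5 G)
    (h32 : ∀ (N : Matroid α') [N.Finite] (G : Finset α'), CellHyp N G →
      (gr N \ G).card = 3 → kColoops N G = 2 → FatMember N G 4 4 →
      (FatBasis N G 4 3 ∨ FatMember N G 4 2) → (FatBasis N G 4 2 ∨ FatMember N G 4 3) → LocalShadowHall N 5 G)
    (M : Matroid α') [M.Finite] : ShadowHall M 7 5 (phiK 7 5) := by
  apply shadowHall_seven_five_of_local_d_le_three
  intro N _ hs hl hr G hG h2 h3 hk1 hk2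
  have hcell : CellHyp N G := ⟨hs, hl, hr, hG⟩
  have hd : (gr N \ G).card = 2 ∨ (gr N \ G).card = 3 := by omega
  rcases hd with hd | hd
  · have hk : kColoops N G = 0 ∨ kColoops N G = 1 := by omega
    rcases hk with hk | hk
    · -- (2, 0)
      by_cases hsp : FatMember N G 0 4
      · by_cases hpa : FatMember N G 6 5
        · by_cases hs2 : FatBasis N G 6 3 ∨ FatMember N G 6 2
          · by_cases hs3 : FatBasis N G 6 2 ∨ FatMember N G 6 3
            · exact h20 N G hcell hd hk hsp hpa hs2 hs3
            · push Not at hs3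
              exact localShadowHall_two_zero_five_of_spread3 hG hd hk hs hl
                (fun B hB h6 => by have := hs3.2 B hB h6; omega)
                (fun B hB h6 => by have := hs3.1 B hB h6; omega)
          · push Not at hs2
            exact localShadowHall_two_zero_five_of_spread2 hG hd hk hs hl
              (fun B hB h6 => by have := hs2.2 B hB h6; omega)
              (fun B hB h6 => by have := hs2.1 B hB h6; omega)
        · push Not at hpa
          exact localShadowHall_two_zero_five_of_partial hG hd hk hs hl
            (fun B hB h6 => by have := hpa B hB h6; omega)
      · push Not at hsp
        exact localShadowHall_two_zero_five_of_spread hG hd hk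
          (fun B hB => by have := hsp B hB (Nat.zero_le _); omega)
    · -- (2, 1)
      by_cases hpa : FatMember N G 5 6
      · by_cases hs2 : FatBasis N G 5 3 ∨ FatMember N G 5 3
        · by_cases hs3 : FatBasis N G 5 2 ∨ FatMember N G 5 4
          · exact h21 N G hcell hd hk hpa hs2 hs3
          · push Not at hs3
            exact localShadowHall_two_one_five_of_spread3 hG hd hk hs hl
              (fun B hB h5 => by have := hs3.2 B hB h5; omega)
              (fun B hB h5 => by have := hs3.1 B hB h5; omega)
        · push Not at hs2
          exact localShadowHall_two_one_five_of_spread2 hG hd hk hs hl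
            (fun B hB h5 => by have := hs2.2 B hB h5; omega)
            (fun B hB h5 => by have := hs2.1 B hB h5; omega)
      · push Not at hpa
        exact localShadowHall_two_one_five_of_partial hG hd hk hs hl
          (fun B hB h5 => by have := hpa B hB h5; omega)
  · have hk : kColoops N G = 0 ∨ kColoops N G = 1 ∨ kColoops N G = 2 := by omega
    rcases hk with hk | hk | hk
    · -- (3, 0)
      by_cases hsp : FatMember N G 0 3
      · by_cases hcard : G.card ≤ 15
        · by_cases hpa : FatMember N G 6 3
          · by_cases hs2 : FatBasis N G 6 2
            · exact h30 N G hcell hd hk hcard hsp hpa hs2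
            · push Not at hs2
              exact localShadowHall_three_zero_five_of_spread2 hG hd hk hs hl
                (fun B hB _ => two_le_card_sdiff_of_not_lay0 hG (by omega) (mem_thinMembers.1 hB).1
                  (mem_thinMembers.1 hB).2)
                (fun B hB h6 => by have := hs2 B hB h6; omega)
          · push Not at hpa
            exact localShadowHall_three_zero_five_of_partial hG hd hk hs hl
              (fun B hB h6 => by have := hpa B hB h6; omega)
        · exact localShadowHall_three_zero_five_of_card hG hd hk hs hl (by omega)
      · push Not at hsp
        exact localShadowHall_three_zero_five_of_spread hG hd hk
          (fun B hB => by have := hsp B hB (Nat.zero_le _); omega)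
    · -- (3, 1)
      by_cases hsp : FatMember N G 0 5
      · by_cases hcard : G.card ≤ 20
        · by_cases hpa : FatMember N G 5 3
          · by_cases hs2 : FatBasis N G 5 4
            · by_cases hs3 : FatBasis N G 5 2 ∨ FatMember N G 5 2
              · exact h31 N G hcell hd hk hcard hsp hpa hs2 hs3
              · push Not at hs3
                exact localShadowHall_three_one_five_of_spread3 hG hd hk hs hl
                  (fun B hB h5 => by have := hs3.2 B hB h5; omega)
                  (fun B hB h5 => by have := hs3.1 B hB h5; omega)
            · push Not at hs2
              exact localShadowHall_three_one_five_of_spread2 hG hd hk hs hl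
                (fun B hB _ => two_le_card_sdiff_of_not_lay0 hG (by omega) (mem_thinMembers.1 hB).1
                  (mem_thinMembers.1 hB).2)
                (fun B hB h5 => by have := hs2 B hB h5; omega)
          · push Not at hpa
            exact localShadowHall_three_one_five_of_partial hG hd hk hs hl
              (fun B hB h5 => by have := hpa B hB h5; omega)
        · exact localShadowHall_three_one_five_of_card hG hd hk hs hl (by omega)
      · push Not at hsp
        exact localShadowHall_three_one_five_of_spread hG hd hk
          (fun B hB => by have := hsp B hB (Nat.zero_le _); omega)
    · -- (3, 2)
      by_cases hpa : FatMember N G 4 4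
      · by_cases hs2 : FatBasis N G 4 3 ∨ FatMember N G 4 2
        · by_cases hs3 : FatBasis N G 4 2 ∨ FatMember N G 4 3
          · exact h32 N G hcell hd hk hpa hs2 hs3
          · push Not at hs3
            exact localShadowHall_three_two_five_of_spread3 hG hd hk hs hl
              (fun B hB h4 => by have := hs3.2 B hB h4; omega)
              (fun B hB h4 => by have := hs3.1 B hB h4; omega)
        · push Not at hs2
          exact localShadowHall_three_two_five_of_spread2 hG hd hk hs hl
            (fun B hB h4 => by have := hs2.2 B hB h4; omega)
            (fun B hB h4 => by have := hs2.1 B hB h4; omega)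
      · push Not at hpa
        exact localShadowHall_three_two_five_of_partial hG hd hk hs hl
          (fun B hB h4 => by have := hpa B hB h4; omega)

end SevenFive

end PercRepro.Shadow
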